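import Literature.MathematicalPhysics.QuantumFieldTheory.Balaban1983to89.B9Eq319BumpSectionLaplacianFlat

/-!
# `Balaban1983to89.B9Eq319BumpSectionLaplacianBackground` — T. Bałaban, *Propagators for lattice gauge theories in a background field*, Commun. Math.
# Phys. **99** (1985) 389–434 [Balaban1985BackgroundPropagators] (3.19) p. 393, (3.23) p. 394, (3.35) p. 396, Cor. 3.6 p. 408 with (3.87)–(3.89) p. 409:
# **THE LAPLACIAN LETTER OF A BUMP SECTION AT A BACKGROUND — for the transport-free section `Ψg(x) = φ(x)·g(ȳ(x))` and ANY transporters `R`, `S`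
# with `S_b∘R_b = 1`, `(Δ_U Ψg)(x)` is the flat second-difference term plus three transport terms carrying the DISPLAYED letters (ε₁) `‖R_bw − w‖,
# ‖S_bw − w‖ ≤ ε₁‖w‖` (bond window) and (ε₂) `‖S_{(x−e_μ,μ)}w + R_{(x,μ)}w − 2w‖ ≤ ε₂‖w‖` (collinear bonds `(x−e_μ,μ)`, `(x,μ)` — adjacent and parallel; second order); hence
# `‖Δ_U(Ψg)‖ ≤ ‖c‖²·d·(ℓ₂ + M_φε₂ + 2ℓ₁ε₁)·√(c₀L^d∕c₁)·‖g‖`, on print's diagonal `≤ (d(3∕2)^d9π²2^{d−1} + d3^d·(L²ε₂) + d(3∕2)^d6π2^{d−1}·(Lε₁))·‖g‖`**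
# (the Laplacian half of the `hCΨ` letter of `B9Eq387CubeLocalisedProjection.norm_sub_projR_cube_le(_weighted)` AT A BACKGROUND; exactness `Q′(U)Ψ_U = 1` is
# restored in the sequel `B9Eq319BumpSectionBackgroundExact`)

statement-level skeleton of published theorems with citation tags; proofs where landed; nothing here is a claim about the Yang–Mills mass gap

CITATION HEADER (lean-in-tree rule).  Audit cell `pub-balaban`, sub-cell `t4`, BINDER row NE9; filed by NE9 formalisation-swarm LEAF PROVER 05
(`b2b-balaban-t4-ne9-formalise-leaf-05`, gen 76), route R2′ STEP B8′ S-P6′(β) (ROUTES-NE9 §L1.2; t4-ne9-idea-1 W-(P-CΨ)): the sequel promised in the header of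
this lineage's `B9Eq319BumpSectionLaplacianFlat` (gen 75: the FLAT half, «at a background `U` … two more letters enter … NOT done here»).  Sources READ:
[Balaban1985BackgroundPropagators] p. 393 (3.19) (block averaging with contour transporters), p. 394 (3.23) `Δ^η_U = D*_UD_U`, p. 396 (3.35) *«there exists a
gauge transformation u on □ such that U^u = e^{iηA} … |A| < O(1)Mα₀(L^jη)⁻¹, |∇^ηA| < O(1)Mα₀(L^jη)⁻²»* (the class in which the two transport letters below are
small on the proper scale: `ε₁ = O(αη)`, `ε₂ = O(|∇^ηA|η² + α²η²)` — a READING recorded in the docstrings, NOT typed against print's class), p. 408 Cor. 3.6,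
p. 409 (3.87)–(3.89).  A bump section is the CHAIN's device (ROUTES-NE9 kernels 5∕6), NOT print's (random-walk expansions); NOTHING of print's estimates is asserted.

WHY.  S-P6′(β) `norm_sub_projR_cube_le` displays a section `Ψ` of the gauge-parameter averaging (`hΨ : Q′Ψ = 1`) with a LAPLACIAN letter
`hCΨ : ‖Δ_s(Ψg)‖ ≤ C_Ψ‖g‖`; gen 75 inhabited both at `U = 1` with an absolute constant.  At a background the covariant Laplacian of `φ ⊗ g∘ȳ` picks up
`φ(x)·((S⁻ − 1) + (R⁺ − 1))g(ȳ)` and two cross terms `(φ(x ∓ e_μ) − φ(x))·(T − 1)g(ȳ)`; with `c = η⁻¹` the first is `η⁻²ε₂` and the second `η⁻²ℓ₁ε₁ = O(η⁻¹ε₁)`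
(`ℓ₁ = O(L⁻¹)`, `Lη = 1`) — bounded on the proper scale exactly when `ε₂ = O(η²)` (the transporters of two collinear consecutive bonds agree to SECOND order: in a normed ring
`(U − 1) + (V⁻¹ − 1) = (U − V) + V⁻¹(V − 1)²`) and `ε₁ = O(η)`.  (`Q′(U)Ψ = 1 + E` with `E` small by (ρ′) — the sequel inverts it.)

WHAT IS PROVED (sorry-free; proof lane — no `def`; the section enters through the POINTWISE letter `hΨ : (Ψg)(x) = φ(x)·g(ȳ(x))`, an existence clause
packages it; [folklore] discrete Leibniz at a block-constant factor + finite sums + finite-dimensional invertibility).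
* §1 **`equiv_covLaplaceSiteK_section_transport`** — the pointwise identity at ANY `R`, `S` with `hSR : S_b(R_bw) = w`.
* §2 **`norm_equiv_covLaplaceSiteK_section_transport_le`** — `‖(Δ_UΨg)(x)‖ ≤ ‖c‖²·d(ℓ₂ + M_φε₂ + 2ℓ₁ε₁)·‖g(ȳ(x))‖` under the profile letters `|φ| ≤ M_φ`,
  `|φ(b₊) − φ(b₋)| ≤ ℓ₁`, `|Δ²_μφ| ≤ ℓ₂` and the transport letters (ε₁), (ε₂).
* §3 **`norm_covLaplaceSiteK_section_transport_le`** — the `L²` bound `× √(c₀L^d∕c₁)·‖g‖`; `norm_section_le` (`‖Ψg‖ ≤ M_φ√(c₀L^d∕c₁)‖g‖`).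
* §4 **`norm_covLaplaceSiteK_section_transport_le_diagonal`** — with the cosine-bump letters of `B9Eq319BumpProfileCos`, `c = η⁻¹`, `Lη = 1`, `c₁ = c₀L^d`,
  `L ≥ 3`: `≤ (d(3∕2)^d·9π²·2^{d−1} + d·3^d·(L²ε₂) + d(3∕2)^d·6π·2^{d−1}·(Lε₁))·‖g‖` — the PROPER-SCALE letters `L²ε₂`, `Lε₁` displayed, nothing else.
* §5 **`exists_inverse_of_norm_sub_le`** — [folklore] on a finite-dimensional normed group, linear over any division ring: `‖Tv − v‖ ≤ q‖v‖`, `q < 1` ⟹ a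
  two-sided linear inverse with `‖T⁻¹v‖ ≤ (1 − q)⁻¹‖v‖` (injectivity + `LinearEquiv.ofInjectiveEndo`; no Neumann series) — the tool the sequel inverts
  `Q′(U)Ψ = 1 + E` with.
HONEST SCOPE.  ONE averaging step (`Q′` of (3.19), blocks of side `L`), NOT the composite `Q′_k` (whose axial-transport sections are not `k`-uniform — this
lineage's W-7 (a), journal 2026-08-23); transport letters DISPLAYED, not discharged (print's (3.35) lives on another carrier, `B9Eq335RegularityClasses`); no
cut-off `θ`, no weights, no minimiser — ONE letter of ONE sub-step of a route step, NOT NE9 (cell pub-balaban: NE9 NOT PRINTED ∕ NOT PROVED; «NE9 ⇐ the named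
binders»; row WALLED ON A MODEL (O-NE9-1; #5 UNRULED); spine PROVED 0∕9; rung (B)+1 on a finite T⁴ — NOT infinite volume, NOT mass gap, NOT BetaPertH, NOT Clay;
HONEST DEPENDENCY: continuum YM on T⁴ ⇐ BetaPertH ∧ nine spine estimates (0/9 proved); BetaPertH ⇐ (D1) ∧ (D4) ∧ CAP+tail; G-an2-4 gates asym, D1 and NE2/3/4).
NEW file; imports `B9Eq319BumpSectionLaplacianFlat` only; nothing modified.  Net new unproved facts: 0.
-/

noncomputable section

open scoped InnerProductSpace BigOperators

namespace Literature.MathematicalPhysics.QuantumFieldTheory.Balaban1983to89.B9Eq319BumpSectionLaplacianBackground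

open B4Sect5Torus (TSite)
open B9SectCLatticeCarrier (Bond bpos btgt shift unshift shift_unshift)
open B9Eq311L2Pairing (WL2)
open B11Eq103H1Complex (SiteL2K covLaplaceSiteK covDerivL2K covDivL2K equiv_covDerivL2K equiv_covDivL2K)
open B9Eq33CovDerivVector (covDeriv covDiv covDeriv_apply_dir covDiv_apply)
open B9Eq319QprimeTorus (fineP blockCoord)
open B9Eq319QprimeTowerFlatSection (sum_norm_sq_comp_blockCoord)
open B9Eq319BumpProfileCos (bumpProfileCos_const_le)
open B9Eq319BumpSectionLaplacianFlat (smul_apply_shift_eq smul_apply_unshift_eq)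

variable {d : ℕ} (L : ℕ) [NeZero L] (m : Fin d → ℕ)
  {W : Type*} [NormedAddCommGroup W] [InnerProductSpace ℂ W]

/-! ## §1 The covariant Laplacian of the section, pointwise, at any transporters -/

section Transport

variable {c₀ c₁ : ℝ} [Fact (0 < c₀)] [Fact (0 < c₁)]
  {φ : TSite d (fineP L m) → ℝ}
  (hcross : ∀ b : Bond d (fineP L m), blockCoord L m (btgt b) ≠ blockCoord L m (bpos b) → φ (bpos b) = 0 ∧ φ (btgt b) = 0)
  {Ψ : SiteL2K ℂ d m c₁ W →ₗ[ℂ] SiteL2K ℂ d (fineP L m) c₀ W}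
  (hΨ : ∀ (g : SiteL2K ℂ d m c₁ W) (x : TSite d (fineP L m)),
    WL2.equiv ℂ _ W (Ψ g) x = ((φ x : ℝ) : ℂ) • WL2.equiv ℂ _ W g (blockCoord L m x))
  (c : ℂ) {R S : Bond d (fineP L m) → W →ₗ[ℂ] W} (hSR : ∀ b w, S b (R b w) = w)

include hcross hΨ hSR

omit [NeZero L] [Fact (0 < c₁)] in
/-- **(3.23) ON THE SECTION, POINTWISE, AT ANY TRANSPORTERS**: with `G = g(ȳ(x))`, `S⁻ = S(x − e_μ, μ)`, `R⁺ = R(x, μ)` and `S_b∘R_b = 1`,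
`(Δ_U Ψg)(x) = c²·Σ_μ [Δ²_μφ(x)·G − (φ(x)·((S⁻G − G) + (R⁺G − G)) + (φ(x−e_μ) − φ(x))·(S⁻G − G) + (φ(x+e_μ) − φ(x))·(R⁺G − G))]` — the flat second
difference plus the transport terms (the block index frozen by the profile's cross clause). [cite: Balaban1985BackgroundPropagators, (3.23) p.394, (3.3) p.391, (3.8) p.392, (3.19) p.393] -/
theorem equiv_covLaplaceSiteK_section_transport (g : SiteL2K ℂ d m c₁ W) (x : TSite d (fineP L m)) :
    WL2.equiv ℂ _ W (covLaplaceSiteK c R S (Ψ g)) x =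
      (c * c) • ∑ μ, ((((φ x : ℝ) : ℂ) - ((φ (unshift μ x) : ℝ) : ℂ) - (((φ (shift μ x) : ℝ) : ℂ) - ((φ x : ℝ) : ℂ))) •
            WL2.equiv ℂ _ W g (blockCoord L m x) -
          (((φ x : ℝ) : ℂ) • ((S (unshift μ x, μ) (WL2.equiv ℂ _ W g (blockCoord L m x)) - WL2.equiv ℂ _ W g (blockCoord L m x)) +
              (R (x, μ) (WL2.equiv ℂ _ W g (blockCoord L m x)) - WL2.equiv ℂ _ W g (blockCoord L m x))) +
            (((φ (unshift μ x) : ℝ) : ℂ) - ((φ x : ℝ) : ℂ)) • (S (unshift μ x, μ) (WL2.equiv ℂ _ W g (blockCoord L m x)) - WL2.equiv ℂ _ W g (blockCoord L m x)) +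
            (((φ (shift μ x) : ℝ) : ℂ) - ((φ x : ℝ) : ℂ)) • (R (x, μ) (WL2.equiv ℂ _ W g (blockCoord L m x)) - WL2.equiv ℂ _ W g (blockCoord L m x)))) := by
  unfold covLaplaceSiteK
  rw [LinearMap.comp_apply, equiv_covDivL2K, covDiv_apply, equiv_covDerivL2K, mul_smul]
  congr 1
  rw [Finset.smul_sum]
  refine Finset.sum_congr rfl fun μ _ => ?_
  rw [covDeriv_apply_dir, covDeriv_apply_dir]
  simp only [shift_unshift, hΨ]
  rw [smul_apply_shift_eq L m hcross, smul_apply_unshift_eq L m hcross]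
  simp only [map_smul, map_sub, smul_sub, hSR]
  module

/-! ## §2 The pointwise bound with the profile and transport letters -/

omit [NeZero L] [Fact (0 < c₁)] in
/-- **POINTWISE BOUND**: `‖(Δ_UΨg)(x)‖ ≤ ‖c‖²·d·(ℓ₂ + M_φε₂ + 2ℓ₁ε₁)·‖g(ȳ(x))‖` under the profile letters `|φ| ≤ M_φ`, `|φ(b₊) − φ(b₋)| ≤ ℓ₁`,
`|Δ²_μφ| ≤ ℓ₂` and the transport letters (ε₁) `‖R_bw − w‖, ‖S_bw − w‖ ≤ ε₁‖w‖`, (ε₂) `‖(S(x−e_μ,μ)w − w) + (R(x,μ)w − w)‖ ≤ ε₂‖w‖`.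
[cite: Balaban1985BackgroundPropagators, (3.23) p.394, (3.35) p.396] -/
theorem norm_equiv_covLaplaceSiteK_section_transport_le {Mφ ℓ₁ ℓ₂ ε₁ ε₂ : ℝ} (hφM : ∀ y, |φ y| ≤ Mφ)
    (hℓ₁ : ∀ b : Bond d (fineP L m), |φ (btgt b) - φ (bpos b)| ≤ ℓ₁)
    (hℓ₂ : ∀ (y : TSite d (fineP L m)) (μ : Fin d), |(φ y - φ (unshift μ y)) - (φ (shift μ y) - φ y)| ≤ ℓ₂)
    (hR1 : ∀ b w, ‖R b w - w‖ ≤ ε₁ * ‖w‖) (hS1 : ∀ b w, ‖S b w - w‖ ≤ ε₁ * ‖w‖)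
    (h2 : ∀ (y : TSite d (fineP L m)) (μ : Fin d) (w : W), ‖(S (unshift μ y, μ) w - w) + (R (y, μ) w - w)‖ ≤ ε₂ * ‖w‖)
    (g : SiteL2K ℂ d m c₁ W) (x : TSite d (fineP L m)) :
    ‖WL2.equiv ℂ _ W (covLaplaceSiteK c R S (Ψ g)) x‖ ≤
      ‖c‖ ^ 2 * (d * (ℓ₂ + Mφ * ε₂ + 2 * ℓ₁ * ε₁)) * ‖WL2.equiv ℂ _ W g (blockCoord L m x)‖ := by
  rw [equiv_covLaplaceSiteK_section_transport L m hcross hΨ c hSR, norm_smul, norm_mul, ← sq]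
  set G := WL2.equiv ℂ _ W g (blockCoord L m x) with hG
  have hM0 : 0 ≤ Mφ := (abs_nonneg _).trans (hφM x)
  have key : ∀ μ : Fin d,
      ‖(((φ x : ℝ) : ℂ) - ((φ (unshift μ x) : ℝ) : ℂ) - (((φ (shift μ x) : ℝ) : ℂ) - ((φ x : ℝ) : ℂ))) • G -
          (((φ x : ℝ) : ℂ) • ((S (unshift μ x, μ) G - G) + (R (x, μ) G - G)) +
            (((φ (unshift μ x) : ℝ) : ℂ) - ((φ x : ℝ) : ℂ)) • (S (unshift μ x, μ) G - G) +
            (((φ (shift μ x) : ℝ) : ℂ) - ((φ x : ℝ) : ℂ)) • (R (x, μ) G - G))‖ ≤ (ℓ₂ + Mφ * ε₂ + 2 * ℓ₁ * ε₁) * ‖G‖ := by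
    intro μ
    have e1 : (((φ x : ℝ) : ℂ) - ((φ (unshift μ x) : ℝ) : ℂ) - (((φ (shift μ x) : ℝ) : ℂ) - ((φ x : ℝ) : ℂ))) =
        ((((φ x - φ (unshift μ x)) - (φ (shift μ x) - φ x) : ℝ)) : ℂ) := by push_cast; ring
    have e2 : (((φ (unshift μ x) : ℝ) : ℂ) - ((φ x : ℝ) : ℂ)) = (((φ (unshift μ x) - φ x : ℝ)) : ℂ) := by push_cast; ring
    have e3 : (((φ (shift μ x) : ℝ) : ℂ) - ((φ x : ℝ) : ℂ)) = (((φ (shift μ x) - φ x : ℝ)) : ℂ) := by push_cast; ring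
    have hA : ‖(((φ x : ℝ) : ℂ) - ((φ (unshift μ x) : ℝ) : ℂ) - (((φ (shift μ x) : ℝ) : ℂ) - ((φ x : ℝ) : ℂ))) • G‖ ≤ ℓ₂ * ‖G‖ := by
      rw [e1, norm_smul, Complex.norm_real, Real.norm_eq_abs]
      exact mul_le_mul_of_nonneg_right (hℓ₂ x μ) (norm_nonneg _)
    have hB : ‖((φ x : ℝ) : ℂ) • ((S (unshift μ x, μ) G - G) + (R (x, μ) G - G))‖ ≤ Mφ * (ε₂ * ‖G‖) := by
      rw [norm_smul, Complex.norm_real, Real.norm_eq_abs]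
      exact mul_le_mul (hφM x) (h2 x μ G) (norm_nonneg _) hM0
    have hl₁ : |φ (unshift μ x) - φ x| ≤ ℓ₁ := by
      have h := hℓ₁ (unshift μ x, μ)
      simp only [btgt, bpos, shift_unshift] at h
      rwa [abs_sub_comm] at h
    have hl₁' : |φ (shift μ x) - φ x| ≤ ℓ₁ := hℓ₁ (x, μ)
    have hℓ10 : 0 ≤ ℓ₁ := (abs_nonneg _).trans hl₁'
    have hC : ‖(((φ (unshift μ x) : ℝ) : ℂ) - ((φ x : ℝ) : ℂ)) • (S (unshift μ x, μ) G - G)‖ ≤ ℓ₁ * (ε₁ * ‖G‖) := by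
      rw [e2, norm_smul, Complex.norm_real, Real.norm_eq_abs]
      exact mul_le_mul hl₁ (hS1 _ G) (norm_nonneg _) hℓ10
    have hD : ‖(((φ (shift μ x) : ℝ) : ℂ) - ((φ x : ℝ) : ℂ)) • (R (x, μ) G - G)‖ ≤ ℓ₁ * (ε₁ * ‖G‖) := by
      rw [e3, norm_smul, Complex.norm_real, Real.norm_eq_abs]
      exact mul_le_mul hl₁' (hR1 _ G) (norm_nonneg _) hℓ10
    calc _ ≤ ‖(((φ x : ℝ) : ℂ) - ((φ (unshift μ x) : ℝ) : ℂ) - (((φ (shift μ x) : ℝ) : ℂ) - ((φ x : ℝ) : ℂ))) • G‖ +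
          ‖((φ x : ℝ) : ℂ) • ((S (unshift μ x, μ) G - G) + (R (x, μ) G - G)) +
            (((φ (unshift μ x) : ℝ) : ℂ) - ((φ x : ℝ) : ℂ)) • (S (unshift μ x, μ) G - G) +
            (((φ (shift μ x) : ℝ) : ℂ) - ((φ x : ℝ) : ℂ)) • (R (x, μ) G - G)‖ := norm_sub_le _ _
      _ ≤ ‖(((φ x : ℝ) : ℂ) - ((φ (unshift μ x) : ℝ) : ℂ) - (((φ (shift μ x) : ℝ) : ℂ) - ((φ x : ℝ) : ℂ))) • G‖ +
          (‖((φ x : ℝ) : ℂ) • ((S (unshift μ x, μ) G - G) + (R (x, μ) G - G))‖ +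
            ‖(((φ (unshift μ x) : ℝ) : ℂ) - ((φ x : ℝ) : ℂ)) • (S (unshift μ x, μ) G - G)‖ +
            ‖(((φ (shift μ x) : ℝ) : ℂ) - ((φ x : ℝ) : ℂ)) • (R (x, μ) G - G)‖) := add_le_add le_rfl norm_add₃_le
      _ ≤ ℓ₂ * ‖G‖ + (Mφ * (ε₂ * ‖G‖) + ℓ₁ * (ε₁ * ‖G‖) + ℓ₁ * (ε₁ * ‖G‖)) := by gcongr
      _ = (ℓ₂ + Mφ * ε₂ + 2 * ℓ₁ * ε₁) * ‖G‖ := by ring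
  have hsum := (norm_sum_le (Finset.univ : Finset (Fin d)) _).trans (Finset.sum_le_sum fun μ _ => key μ)
  rw [Finset.sum_const, Finset.card_univ, Fintype.card_fin, nsmul_eq_mul] at hsum
  have h0 : 0 ≤ ‖c‖ ^ 2 := sq_nonneg _
  calc ‖c‖ ^ 2 * ‖∑ μ, ((((φ x : ℝ) : ℂ) - ((φ (unshift μ x) : ℝ) : ℂ) - (((φ (shift μ x) : ℝ) : ℂ) - ((φ x : ℝ) : ℂ))) • G -
          (((φ x : ℝ) : ℂ) • ((S (unshift μ x, μ) G - G) + (R (x, μ) G - G)) +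
            (((φ (unshift μ x) : ℝ) : ℂ) - ((φ x : ℝ) : ℂ)) • (S (unshift μ x, μ) G - G) +
            (((φ (shift μ x) : ℝ) : ℂ) - ((φ x : ℝ) : ℂ)) • (R (x, μ) G - G)))‖
      ≤ ‖c‖ ^ 2 * ((d : ℝ) * ((ℓ₂ + Mφ * ε₂ + 2 * ℓ₁ * ε₁) * ‖G‖)) := mul_le_mul_of_nonneg_left hsum h0
    _ = ‖c‖ ^ 2 * (d * (ℓ₂ + Mφ * ε₂ + 2 * ℓ₁ * ε₁)) * ‖G‖ := by ring

/-! ## §3 The `L²` bounds -/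

/-- **THE `L²` BOUND**: `‖Δ_U(Ψg)‖_{L²(c₀)} ≤ ‖c‖²·d(ℓ₂ + M_φε₂ + 2ℓ₁ε₁)·√(c₀L^d∕c₁)·‖g‖_{L²(c₁)}` — the pointwise bound squared and summed over
the blocks (`Σ_x ‖g(ȳ(x))‖² = L^d·Σ_y ‖g(y)‖²`). [cite: Balaban1985BackgroundPropagators, (3.23) p.394, (3.19) p.393, (3.35) p.396] -/
theorem norm_covLaplaceSiteK_section_transport_le {Mφ ℓ₁ ℓ₂ ε₁ ε₂ : ℝ} (hM0 : 0 ≤ Mφ) (hℓ10 : 0 ≤ ℓ₁) (hℓ0 : 0 ≤ ℓ₂)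
    (hε₁ : 0 ≤ ε₁) (hε₂ : 0 ≤ ε₂) (hφM : ∀ y, |φ y| ≤ Mφ)
    (hℓ₁ : ∀ b : Bond d (fineP L m), |φ (btgt b) - φ (bpos b)| ≤ ℓ₁)
    (hℓ₂ : ∀ (y : TSite d (fineP L m)) (μ : Fin d), |(φ y - φ (unshift μ y)) - (φ (shift μ y) - φ y)| ≤ ℓ₂)
    (hR1 : ∀ b w, ‖R b w - w‖ ≤ ε₁ * ‖w‖) (hS1 : ∀ b w, ‖S b w - w‖ ≤ ε₁ * ‖w‖)
    (h2 : ∀ (y : TSite d (fineP L m)) (μ : Fin d) (w : W), ‖(S (unshift μ y, μ) w - w) + (R (y, μ) w - w)‖ ≤ ε₂ * ‖w‖)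
    (g : SiteL2K ℂ d m c₁ W) :
    ‖covLaplaceSiteK c R S (Ψ g)‖ ≤ ‖c‖ ^ 2 * (d * (ℓ₂ + Mφ * ε₂ + 2 * ℓ₁ * ε₁)) * Real.sqrt (c₀ * (L : ℝ) ^ d / c₁) * ‖g‖ := by
  have hc₀ : 0 < c₀ := Fact.out
  have hc₁ : 0 < c₁ := Fact.out
  set K : ℝ := ‖c‖ ^ 2 * (d * (ℓ₂ + Mφ * ε₂ + 2 * ℓ₁ * ε₁)) with hK
  have hK0 : 0 ≤ K := by rw [hK]; positivity
  clear_value K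
  have hg : ‖g‖ ^ 2 = ∑ y, c₁ * ‖WL2.equiv ℂ _ W g y‖ ^ 2 := WL2.norm_sq (𝕜 := ℂ) (w := fun _ : TSite d m => c₁) (V := W) g
  have hr : Real.sqrt (c₀ * (L : ℝ) ^ d / c₁) ^ 2 = c₀ * (L : ℝ) ^ d / c₁ := Real.sq_sqrt (by positivity)
  have hpt : ∀ x, ‖WL2.equiv ℂ _ W (covLaplaceSiteK c R S (Ψ g)) x‖ ≤ K * ‖WL2.equiv ℂ _ W g (blockCoord L m x)‖ :=
    fun x => by rw [hK]; exact norm_equiv_covLaplaceSiteK_section_transport_le L m hcross hΨ c hSR hφM hℓ₁ hℓ₂ hR1 hS1 h2 g x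
  have hsq : ‖covLaplaceSiteK c R S (Ψ g)‖ ^ 2 ≤ (K * Real.sqrt (c₀ * (L : ℝ) ^ d / c₁) * ‖g‖) ^ 2 := by
    rw [WL2.norm_sq (𝕜 := ℂ) (w := fun _ : TSite d (fineP L m) => c₀) (V := W)]
    calc ∑ x, c₀ * ‖WL2.equiv ℂ _ W (covLaplaceSiteK c R S (Ψ g)) x‖ ^ 2
        ≤ ∑ x, c₀ * (K * ‖WL2.equiv ℂ _ W g (blockCoord L m x)‖) ^ 2 :=
          Finset.sum_le_sum fun x _ => mul_le_mul_of_nonneg_left (pow_le_pow_left₀ (norm_nonneg _) (hpt x) 2) hc₀.le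
      _ = c₀ * K ^ 2 * ((L : ℝ) ^ d * ∑ y : TSite d m, ‖WL2.equiv ℂ _ W g y‖ ^ 2) := by
          rw [← sum_norm_sq_comp_blockCoord L m (WL2.equiv ℂ _ W g), Finset.mul_sum]
          exact Finset.sum_congr rfl fun x _ => by ring
      _ = K ^ 2 * (c₀ * (L : ℝ) ^ d / c₁) * ∑ y : TSite d m, c₁ * ‖WL2.equiv ℂ _ W g y‖ ^ 2 := by
          rw [← Finset.mul_sum]; field_simp
      _ = (K * Real.sqrt (c₀ * (L : ℝ) ^ d / c₁) * ‖g‖) ^ 2 := by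
          rw [← hg, mul_pow, mul_pow, hr]
  exact (pow_le_pow_iff_left₀ (norm_nonneg _) (by positivity) two_ne_zero).1 hsq

end Transport

section SectionNorm

variable {c₀ c₁ : ℝ} [Fact (0 < c₀)] [Fact (0 < c₁)]
  {φ : TSite d (fineP L m) → ℝ}
  {Ψ : SiteL2K ℂ d m c₁ W →ₗ[ℂ] SiteL2K ℂ d (fineP L m) c₀ W}
  (hΨ : ∀ (g : SiteL2K ℂ d m c₁ W) (x : TSite d (fineP L m)),
    WL2.equiv ℂ _ W (Ψ g) x = ((φ x : ℝ) : ℂ) • WL2.equiv ℂ _ W g (blockCoord L m x))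

include hΨ

/-- **THE NORM OF THE SECTION**: `‖Ψg‖_{L²(c₀)} ≤ M_φ·√(c₀L^d∕c₁)·‖g‖_{L²(c₁)}` (`= M_φ‖g‖` on the diagonal `c₁ = c₀L^d`). [cite: Balaban1985BackgroundPropagators, (3.19) p.393, (3.11) p.392] -/
theorem norm_section_le {Mφ : ℝ} (hM0 : 0 ≤ Mφ) (hφM : ∀ y, |φ y| ≤ Mφ) (g : SiteL2K ℂ d m c₁ W) :
    ‖Ψ g‖ ≤ Mφ * Real.sqrt (c₀ * (L : ℝ) ^ d / c₁) * ‖g‖ := by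
  have hc₀ : 0 < c₀ := Fact.out
  have hc₁ : 0 < c₁ := Fact.out
  have hg : ‖g‖ ^ 2 = ∑ y, c₁ * ‖WL2.equiv ℂ _ W g y‖ ^ 2 := WL2.norm_sq (𝕜 := ℂ) (w := fun _ : TSite d m => c₁) (V := W) g
  have hr : Real.sqrt (c₀ * (L : ℝ) ^ d / c₁) ^ 2 = c₀ * (L : ℝ) ^ d / c₁ := Real.sq_sqrt (by positivity)
  have hpt : ∀ x, ‖WL2.equiv ℂ _ W (Ψ g) x‖ ≤ Mφ * ‖WL2.equiv ℂ _ W g (blockCoord L m x)‖ := fun x => by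
    rw [hΨ, norm_smul, Complex.norm_real, Real.norm_eq_abs]
    exact mul_le_mul_of_nonneg_right (hφM x) (norm_nonneg _)
  have hsq : ‖Ψ g‖ ^ 2 ≤ (Mφ * Real.sqrt (c₀ * (L : ℝ) ^ d / c₁) * ‖g‖) ^ 2 := by
    rw [WL2.norm_sq (𝕜 := ℂ) (w := fun _ : TSite d (fineP L m) => c₀) (V := W)]
    calc ∑ x, c₀ * ‖WL2.equiv ℂ _ W (Ψ g) x‖ ^ 2
        ≤ ∑ x, c₀ * (Mφ * ‖WL2.equiv ℂ _ W g (blockCoord L m x)‖) ^ 2 :=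
          Finset.sum_le_sum fun x _ => mul_le_mul_of_nonneg_left (pow_le_pow_left₀ (norm_nonneg _) (hpt x) 2) hc₀.le
      _ = c₀ * Mφ ^ 2 * ((L : ℝ) ^ d * ∑ y : TSite d m, ‖WL2.equiv ℂ _ W g y‖ ^ 2) := by
          rw [← sum_norm_sq_comp_blockCoord L m (WL2.equiv ℂ _ W g), Finset.mul_sum]
          exact Finset.sum_congr rfl fun x _ => by ring
      _ = Mφ ^ 2 * (c₀ * (L : ℝ) ^ d / c₁) * ∑ y : TSite d m, c₁ * ‖WL2.equiv ℂ _ W g y‖ ^ 2 := by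
          rw [← Finset.mul_sum]; field_simp
      _ = (Mφ * Real.sqrt (c₀ * (L : ℝ) ^ d / c₁) * ‖g‖) ^ 2 := by
          rw [← hg, mul_pow, mul_pow, hr]
  exact (pow_le_pow_iff_left₀ (norm_nonneg _) (by positivity) two_ne_zero).1 hsq

end SectionNorm

/-! ## §4 On print's diagonal with the cosine bump's letters: the proper-scale transport letters displayed -/

section Diagonal

variable {c₀ c₁ : ℝ} [Fact (0 < c₀)] [Fact (0 < c₁)]
  {φ : TSite d (fineP L m) → ℝ}
  (hcross : ∀ b : Bond d (fineP L m), blockCoord L m (btgt b) ≠ blockCoord L m (bpos b) → φ (bpos b) = 0 ∧ φ (btgt b) = 0)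
  (hℓ₁ : ∀ b : Bond d (fineP L m), |φ (btgt b) - φ (bpos b)| ≤ ((L : ℝ) / ((L : ℝ) - 1)) ^ d * (2 * Real.pi / ((L : ℝ) - 1) * 2 ^ (d - 1)))
  (hφM : ∀ x, |φ x| ≤ ((L : ℝ) / ((L : ℝ) - 1)) ^ d * 2 ^ d)
  (hℓ₂ : ∀ (y : TSite d (fineP L m)) (μ : Fin d), |(φ y - φ (unshift μ y)) - (φ (shift μ y) - φ y)| ≤
    ((L : ℝ) / ((L : ℝ) - 1)) ^ d * ((2 * Real.pi / ((L : ℝ) - 1)) ^ 2 * 2 ^ (d - 1)))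
  {Ψ : SiteL2K ℂ d m c₁ W →ₗ[ℂ] SiteL2K ℂ d (fineP L m) c₀ W}
  (hΨ : ∀ (g : SiteL2K ℂ d m c₁ W) (x : TSite d (fineP L m)),
    WL2.equiv ℂ _ W (Ψ g) x = ((φ x : ℝ) : ℂ) • WL2.equiv ℂ _ W g (blockCoord L m x))
  {η : ℝ} (hLη : (L : ℝ) * η = 1) (hL : 3 ≤ L) (hc : c₀ * (L : ℝ) ^ d = c₁)
  {R S : Bond d (fineP L m) → W →ₗ[ℂ] W} (hSR : ∀ b w, S b (R b w) = w) {ε₁ ε₂ : ℝ} (hε₁ : 0 ≤ ε₁) (hε₂ : 0 ≤ ε₂)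
  (hR1 : ∀ b w, ‖R b w - w‖ ≤ ε₁ * ‖w‖) (hS1 : ∀ b w, ‖S b w - w‖ ≤ ε₁ * ‖w‖)
  (h2 : ∀ (y : TSite d (fineP L m)) (μ : Fin d) (w : W), ‖(S (unshift μ y, μ) w - w) + (R (y, μ) w - w)‖ ≤ ε₂ * ‖w‖)

include hcross hℓ₁ hφM hℓ₂ hΨ hLη hL hc hSR hε₁ hε₂ hR1 hS1 h2

/-- **ON THE DIAGONAL THE LAPLACIAN LETTER IS ABSOLUTE UP TO THE PROPER-SCALE TRANSPORT LETTERS**: `c = η⁻¹`, `Lη = 1`, `c₁ = c₀L^d`, `L ≥ 3` and the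
cosine bump's three letters give `‖Δ_U(Ψg)‖ ≤ (d(3∕2)^d·9π²·2^{d−1} + d·3^d·(L²ε₂) + d(3∕2)^d·6π·2^{d−1}·(Lε₁))·‖g‖` — with `ε₂ = βη²`, `ε₁ = αη` this
reads `d(3∕2)^d9π²2^{d−1} + d3^dβ + d(3∕2)^d6π2^{d−1}α`: NO `η`, NO `L`, NO volume. [cite: Balaban1985BackgroundPropagators, (3.23) p.394, (3.19) p.393, (3.35) p.396, (3.89) p.409] -/
theorem norm_covLaplaceSiteK_section_transport_le_diagonal (g : SiteL2K ℂ d m c₁ W) :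
    ‖covLaplaceSiteK ((η : ℂ))⁻¹ R S (Ψ g)‖ ≤
      (d * (3 / 2 : ℝ) ^ d * (9 * Real.pi ^ 2) * 2 ^ (d - 1) + d * 3 ^ d * ((L : ℝ) ^ 2 * ε₂) +
        d * (3 / 2 : ℝ) ^ d * (6 * Real.pi) * 2 ^ (d - 1) * ((L : ℝ) * ε₁)) * ‖g‖ := by
  have hc₀ : 0 < c₀ := Fact.out
  have h3 : (3 : ℝ) ≤ L := by exact_mod_cast hL
  have hL0 : (0 : ℝ) < L := by linarith
  have hL1 : (0 : ℝ) < (L : ℝ) - 1 := by linarith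
  have hη : η = (L : ℝ)⁻¹ := by field_simp; linarith
  obtain ⟨hq, hθ, hM⟩ := bumpProfileCos_const_le (d := d) L hL
  have hM0 : 0 ≤ ((L : ℝ) / ((L : ℝ) - 1)) ^ d * 2 ^ d := by positivity
  have hℓ10 : 0 ≤ ((L : ℝ) / ((L : ℝ) - 1)) ^ d * (2 * Real.pi / ((L : ℝ) - 1) * 2 ^ (d - 1)) := by positivity
  have hℓ0 : 0 ≤ ((L : ℝ) / ((L : ℝ) - 1)) ^ d * ((2 * Real.pi / ((L : ℝ) - 1)) ^ 2 * 2 ^ (d - 1)) := by positivity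
  have h := norm_covLaplaceSiteK_section_transport_le L m hcross hΨ ((η : ℂ))⁻¹ hSR hM0 hℓ10 hℓ0 hε₁ hε₂ hφM hℓ₁ hℓ₂ hR1 hS1 h2 g
  have hnc : ‖((η : ℂ))⁻¹‖ ^ 2 = (L : ℝ) ^ 2 := by
    rw [norm_inv, Complex.norm_real, Real.norm_eq_abs, hη, abs_inv, abs_of_pos hL0, inv_inv]
  have hvol : Real.sqrt (c₀ * (L : ℝ) ^ d / c₁) = 1 := by
    rw [← hc, div_self (by positivity), Real.sqrt_one]
  rw [hnc, hvol, mul_one] at h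
  refine h.trans (mul_le_mul_of_nonneg_right ?_ (norm_nonneg _))
  have h1 : ((L : ℝ) / ((L : ℝ) - 1)) ^ d ≤ (3 / 2 : ℝ) ^ d := pow_le_pow_left₀ (by positivity) hq d
  have h4 : (L : ℝ) * (2 * Real.pi / ((L : ℝ) - 1)) ≤ 3 * Real.pi := by
    calc (L : ℝ) * (2 * Real.pi / ((L : ℝ) - 1)) ≤ (L : ℝ) * (3 * Real.pi / (L : ℝ)) := mul_le_mul_of_nonneg_left hθ hL0.le
      _ = 3 * Real.pi := by field_simp
  have h5 : 0 ≤ (L : ℝ) * (2 * Real.pi / ((L : ℝ) - 1)) := by positivity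
  have h2' : (L : ℝ) ^ 2 * (2 * Real.pi / ((L : ℝ) - 1)) ^ 2 ≤ 9 * Real.pi ^ 2 := by
    have e : (L : ℝ) ^ 2 * (2 * Real.pi / ((L : ℝ) - 1)) ^ 2 = ((L : ℝ) * (2 * Real.pi / ((L : ℝ) - 1))) ^ 2 := by ring
    rw [e, show 9 * Real.pi ^ 2 = (3 * Real.pi) ^ 2 by ring]
    exact pow_le_pow_left₀ h5 h4 2
  -- term by term
  have tA : (L : ℝ) ^ 2 * (d * (((L : ℝ) / ((L : ℝ) - 1)) ^ d * ((2 * Real.pi / ((L : ℝ) - 1)) ^ 2 * 2 ^ (d - 1)))) ≤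
      d * (3 / 2 : ℝ) ^ d * (9 * Real.pi ^ 2) * 2 ^ (d - 1) := by
    calc (L : ℝ) ^ 2 * (d * (((L : ℝ) / ((L : ℝ) - 1)) ^ d * ((2 * Real.pi / ((L : ℝ) - 1)) ^ 2 * 2 ^ (d - 1))))
        = d * ((L : ℝ) / ((L : ℝ) - 1)) ^ d * ((L : ℝ) ^ 2 * (2 * Real.pi / ((L : ℝ) - 1)) ^ 2) * 2 ^ (d - 1) := by ring
      _ ≤ d * (3 / 2 : ℝ) ^ d * (9 * Real.pi ^ 2) * 2 ^ (d - 1) := by gcongr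
  have tB : (L : ℝ) ^ 2 * (d * (((L : ℝ) / ((L : ℝ) - 1)) ^ d * 2 ^ d * ε₂)) ≤ d * 3 ^ d * ((L : ℝ) ^ 2 * ε₂) := by
    calc (L : ℝ) ^ 2 * (d * (((L : ℝ) / ((L : ℝ) - 1)) ^ d * 2 ^ d * ε₂)) = d * (((L : ℝ) / ((L : ℝ) - 1)) ^ d * 2 ^ d) * ((L : ℝ) ^ 2 * ε₂) := by ring
      _ ≤ d * 3 ^ d * ((L : ℝ) ^ 2 * ε₂) := by gcongr
  have tC : (L : ℝ) ^ 2 * (d * (2 * (((L : ℝ) / ((L : ℝ) - 1)) ^ d * (2 * Real.pi / ((L : ℝ) - 1) * 2 ^ (d - 1))) * ε₁)) ≤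
      d * (3 / 2 : ℝ) ^ d * (6 * Real.pi) * 2 ^ (d - 1) * ((L : ℝ) * ε₁) := by
    calc (L : ℝ) ^ 2 * (d * (2 * (((L : ℝ) / ((L : ℝ) - 1)) ^ d * (2 * Real.pi / ((L : ℝ) - 1) * 2 ^ (d - 1))) * ε₁))
        = d * ((L : ℝ) / ((L : ℝ) - 1)) ^ d * (2 * ((L : ℝ) * (2 * Real.pi / ((L : ℝ) - 1)))) * 2 ^ (d - 1) * ((L : ℝ) * ε₁) := by ring
      _ ≤ d * (3 / 2 : ℝ) ^ d * (2 * (3 * Real.pi)) * 2 ^ (d - 1) * ((L : ℝ) * ε₁) := by gcongr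
      _ = d * (3 / 2 : ℝ) ^ d * (6 * Real.pi) * 2 ^ (d - 1) * ((L : ℝ) * ε₁) := by ring
  calc (L : ℝ) ^ 2 * (d * (((L : ℝ) / ((L : ℝ) - 1)) ^ d * ((2 * Real.pi / ((L : ℝ) - 1)) ^ 2 * 2 ^ (d - 1)) +
          ((L : ℝ) / ((L : ℝ) - 1)) ^ d * 2 ^ d * ε₂ +
          2 * (((L : ℝ) / ((L : ℝ) - 1)) ^ d * (2 * Real.pi / ((L : ℝ) - 1) * 2 ^ (d - 1))) * ε₁))
      = (L : ℝ) ^ 2 * (d * (((L : ℝ) / ((L : ℝ) - 1)) ^ d * ((2 * Real.pi / ((L : ℝ) - 1)) ^ 2 * 2 ^ (d - 1)))) +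
          (L : ℝ) ^ 2 * (d * (((L : ℝ) / ((L : ℝ) - 1)) ^ d * 2 ^ d * ε₂)) +
          (L : ℝ) ^ 2 * (d * (2 * (((L : ℝ) / ((L : ℝ) - 1)) ^ d * (2 * Real.pi / ((L : ℝ) - 1) * 2 ^ (d - 1))) * ε₁)) := by ring
    _ ≤ _ := add_le_add (add_le_add tA tB) tC

end Diagonal

/-! ## §5 [folklore] A near-identity map on a finite-dimensional space has a bounded two-sided inverse (the tool of the sequel) -/

section Inverse

variable {K : Type*} [DivisionRing K] {V : Type*} [NormedAddCommGroup V] [Module K V] [FiniteDimensional K V]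

/-- **[folklore] NEAR-IDENTITY INVERSION WITHOUT A NEUMANN SERIES**: on a finite-dimensional space, `‖Tv − v‖ ≤ q‖v‖` with `q < 1` makes `T` injective,
hence bijective, and the inverse satisfies `‖T⁻¹v‖ ≤ (1 − q)⁻¹‖v‖`. [folklore] [cite: Balaban1985BackgroundPropagators, (3.19) p.393] -/
theorem exists_inverse_of_norm_sub_le (T : V →ₗ[K] V) {q : ℝ} (hq : q < 1) (hT : ∀ v, ‖T v - v‖ ≤ q * ‖v‖) :
    ∃ Tinv : V →ₗ[K] V, (∀ v, T (Tinv v) = v) ∧ (∀ v, Tinv (T v) = v) ∧ ∀ v, ‖Tinv v‖ ≤ (1 - q)⁻¹ * ‖v‖ := by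
  have hq0 : 0 < 1 - q := sub_pos.2 hq
  have hbd : ∀ u, ‖u‖ ≤ (1 - q)⁻¹ * ‖T u‖ := fun u => by
    have h1 : ‖u‖ ≤ ‖T u - u‖ + ‖T u‖ := by
      calc ‖u‖ = ‖T u - (T u - u)‖ := by rw [sub_sub_cancel]
        _ ≤ ‖T u‖ + ‖T u - u‖ := norm_sub_le _ _
        _ = ‖T u - u‖ + ‖T u‖ := add_comm _ _
    rw [inv_mul_eq_div, le_div_iff₀ hq0]
    nlinarith [hT u, norm_nonneg u]
  have hinj : Function.Injective T := by
    intro u v huv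
    rw [← sub_eq_zero, ← norm_le_zero_iff]
    have h := hbd (u - v)
    rw [map_sub, huv, sub_self, norm_zero, mul_zero] at h
    exact h
  refine ⟨(LinearEquiv.ofInjectiveEndo T hinj).symm.toLinearMap, fun v => ?_, fun v => ?_, fun v => ?_⟩
  · have h := (LinearEquiv.ofInjectiveEndo T hinj).apply_symm_apply v
    rwa [LinearEquiv.coe_ofInjectiveEndo] at h
  · have h := (LinearEquiv.ofInjectiveEndo T hinj).symm_apply_apply v
    rw [LinearEquiv.coe_ofInjectiveEndo] at h
    exact h
  · have h := hbd ((LinearEquiv.ofInjectiveEndo T hinj).symm v)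
    have e : T ((LinearEquiv.ofInjectiveEndo T hinj).symm v) = v := by
      have h' := (LinearEquiv.ofInjectiveEndo T hinj).apply_symm_apply v
      rwa [LinearEquiv.coe_ofInjectiveEndo] at h'
    rw [e] at h
    exact h

end Inverse

end Literature.MathematicalPhysics.QuantumFieldTheory.Balaban1983to89.B9Eq319BumpSectionLaplacianBackground

end
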